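import Summits.BirchSwinnertonDyer.BirchSwinnertonDyer.Theorems.Rank2Observatory2DescRowCertSound
import HarnessLib

/-!
# BirchSwinnertonDyer — rank ≥ 2 observatory: ROW CERTIFICATES with the rank bound as a PARAMETER — `rank E(ℚ) ≤ r` / `= r` from an `r`-checked row (KERNEL-2DESC v2.0, S2c; the rank-3 arm's share)

HONEST FRAMING: per-curve certified theorems and census instruments; no claim on BSD in rank ≥ 2.

Generic addendum of the KERNEL-2DESC instrument, v2.0 RESHAPE (design `b2b-bsdr2-cert-3/KERNEL-2DESC.md`
§12; gate4 CERT-LANE ruling 2026-08-22: sharded row files, one declaration per curve; rank-3 plan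
`code/b2b-bsdr2-cert-2/v2/RANK3-V2.md`). The landed row checker `CurveCert.check`
(`Rank2Observatory2DescRowCert`) ends in the clause "fewer than `2³` classes survive", and its soundness
theorem `rank_le_two_of_check` (`Rank2Observatory2DescRowCertSound`) concludes `rank ≤ 2`. The general
`2`-descent bound is uniform in the exponent: `#(surviving classes) < 2^(r+1)` gives `rank E(ℚ) ≤ r`
(`mordellWeilRank_le_of_coverSet_lt`, already stated for every `r`). This file makes the bound a parameter:
`CurveCert.checkLe r` is `CurveCert.check` with the last clause replaced by `card < 2 ^ (r + 1)` (every other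
clause byte-identical), `rank_le_of_checkLe` is the landed soundness proof verbatim with the count
generalised, and `rank_eq_of_checkLe` / `rank_eq_of_checkLe_complSq` add a tree lower bound `r ≤ rank` (for
`r = 3`: the kernel certificates `Rank3KernelCerts<k>.C<label>.three_le_rank` of the `9 487` rank-3 rows of
`rank3Table`). With `r = 3` one sharded row replaces a 250–370-line v1.x rank-3 per-curve file
(`Rank2Observatory<label>TwoDescRankThree`: `16` admissible classes and one killed class, `15 < 2⁴`, or `8`
admissible classes) over a landed complex monogenic cubic field. Kernel sanity checks below: the landed
`10120g1` row passes `checkLe 2` (same data as the `check` example), and the KILL-R3 row of `248124a1`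
(field `−31`, `16` admissible classes, the class of the fundamental unit killed modulo `2²`, `15 < 2⁴`;
v1.x file `Rank2Observatory248124a1TwoDescRankThree`) passes `checkLe 3` and fails `checkLe 2`.
Sorry-free; axioms `propext`, `Classical.choice`, `Quot.sound`. [folklore]
[cite: Cassels1991LecturesEllipticCurves, §15] [cite: CremonaAlgorithms1997, §3.6]
-/

-- single-conjunct summit: `Summit.BirchSwinnertonDyer.BirchSwinnertonDyer.…` repeats the name by design
set_option linter.dupNamespace false

open scoped NumberField

open Literature.NumberTheory.NumberFields Polynomial Module NumberField

namespace Summit.BirchSwinnertonDyer.BirchSwinnertonDyer.Rank2Observatory.TwoDescCubic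

/-! ## The `r`-checker -/

/-- **The row checker with the rank bound as a parameter**: the clauses of `CurveCert.check` (elliptic; `F`
has no root mod `p0`; `F(θ) = 0`; `F′(θ) = u·∏ gⱼ^eⱼ`, `u·u⁻¹ = 1`; generators checked and pairwise
distinct; `disc F < 0`; residue moduli positive; the kill-list certificate; no killed class trivial) and,
last, fewer than `2^(r+1)` surviving classes. [cite: Cassels1991LecturesEllipticCurves, §15]
[cite: CremonaAlgorithms1997, §3.6] -/
def CurveCert.checkLe {m : ℕ} (r : ℕ) (a b c : ℤ) (lo hi : ℚ) (ucoords : Fin m → ℤ × ℤ × ℤ) (Nu : Fin m → ℤ)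
    (su : Fin m → Bool) (cc : CurveCert m) : Bool :=
  decide (deltaShort cc.A cc.B cc.C ≠ 0) &&
  noRootMod cc.p0 cc.A cc.B cc.C &&
  decide (cubicAtCoords a b c cc.A cc.B cc.C cc.t = (0, 0, 0)) &&
  decide (derivAtCoords a b c cc.A cc.B cc.t =
    MonicCubic.mulCoords a b c cc.u (prodPowCoords a b c (cc.gens.map fun d => (d.g, d.e)))) &&
  decide (MonicCubic.mulCoords a b c cc.u cc.uinv = (1, 0, 0)) &&
  cc.gens.all (GenData.check a b c lo hi) &&
  decide ((cc.gens.map GenData.g).Nodup) &&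
  decide (MonicCubic.disc cc.A cc.B cc.C < 0) &&
  (cc.Q.all fun q => decide (0 < q)) &&
  killListCheck a b c cc.t.2.1 cc.t.2.2 ucoords cc.cg (cc.killEntries a b c ucoords) &&
  ((cc.killEntries a b c ucoords).all fun e => !(decide (e.T = ∅) && decide (e.U = ∅))) &&
  decide (((Finset.univ ×ˢ Finset.univ).filter
      (fun TU : Finset (Fin m) × Finset (Fin cc.gens.length) =>
        cc.adm a b c ucoords Nu su TU.1 TU.2 = true)).card < 2 ^ (r + 1))


section assembly

variable {K : Type*} [Field K] [NumberField K] {a b c : ℤ} {α : K}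

/-- **Soundness of the `r`-checker: `rank E(ℚ) ≤ r`** (the proof of `rank_le_two_of_check` with the count
clause `card < 2^(r+1)` fed to `mordellWeilRank_le_of_coverSet_lt`). [cite: Cassels1991LecturesEllipticCurves, §15] -/
theorem rank_le_of_checkLe (r : ℕ) [IsPrincipalIdealRing (𝓞 K)]
    (hirr : Irreducible (MonicCubic.polyQ a b c)) (hα : aeval α (MonicCubic.poly a b c) = 0)
    (h3 : finrank ℚ K = 3) {m : ℕ} (Wu : Fin m → (𝓞 K)ˣ)
    (hW : ∀ u : (𝓞 K)ˣ, ∃ T : Finset (Fin m), IsSquare (u * ∏ i ∈ T, Wu i))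
    (ucoords : Fin m → ℤ × ℤ × ℤ)
    (hWu : ∀ i, ((Wu i : (𝓞 K)ˣ) : 𝓞 K) = lin hα (ucoords i).1 (ucoords i).2.1 (ucoords i).2.2)
    {Nu : Fin m → ℤ} (hNu : ∀ i, Algebra.norm ℚ (((Wu i : (𝓞 K)ˣ) : 𝓞 K) : K) = Nu i)
    (ρ : K →+* ℝ) {lo hi : ℚ} (h0 : 0 ≤ lo) (hlo : ((lo : ℚ) : ℝ) < ρ α) (hhi : ρ α < ((hi : ℚ) : ℝ))
    {su : Fin m → Bool} (hsu : ∀ i, (su i = true ↔ ρ (((Wu i : (𝓞 K)ˣ) : 𝓞 K) : K) < 0))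
    (cc : CurveCert m) (hc : cc.checkLe r a b c lo hi ucoords Nu su = true)
    (hprimes : (cc.gens.map GenData.p).Forall Nat.Prime) :
    ((⟨0, cc.A, 0, cc.B, cc.C⟩ : WeierstrassCurve ℚ)).mordellWeilRank ≤ r := by
  classical
  have hprimes' : ∀ d ∈ cc.gens, d.p.Prime := fun d hd =>
    (List.forall_iff_forall_mem.mp hprimes) _ (List.mem_map.mpr ⟨d, hd, rfl⟩)
  simp only [CurveCert.checkLe, Bool.and_eq_true, decide_eq_true_eq, List.all_eq_true] at hc
  obtain ⟨⟨⟨⟨⟨⟨⟨⟨⟨⟨⟨hΔ, hirrF⟩, hθ⟩, hder⟩, huinv⟩, hgens⟩, hnodup⟩, hdisc⟩, hQ⟩, hkill⟩, hTU⟩, hcount⟩ := hc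
  haveI hE := isElliptic_of_deltaShort_ne hΔ
  have hirrF' := irreducible_of_noRootMod hirrF
  have haev := aeval_lin_eq_zero_of_coords hα cc.t hθ
  -- the generators
  set s := cc.gens.length with hs
  set G : Fin s → 𝓞 K := fun j => lin hα (cc.gens.get j).g.1 (cc.gens.get j).g.2.1 (cc.gens.get j).g.2.2
    with hG
  have hGchk : ∀ j : Fin s, (cc.gens.get j).check a b c lo hi = true := fun j => hgens _ (List.get_mem _ _)
  have hGp : ∀ j, Prime (G j) := fun j =>
    GenData.prime_of_check hirr hα h3 (hGchk j) (hprimes' _ (List.get_mem _ _))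
  have hGi : Function.Injective G := by
    intro i j hij
    by_contra hne
    have hgne : (cc.gens.get i).g ≠ (cc.gens.get j).g := by
      intro hg
      apply hne
      have hinj := List.inj_on_of_nodup_map hnodup
      have heq : cc.gens.get i = cc.gens.get j := hinj (List.get_mem _ _) (List.get_mem _ _) hg
      exact (List.Nodup.get_inj_iff (List.Nodup.of_map _ hnodup)).mp heq
    have hne3 : (cc.gens.get i).g.1 ≠ (cc.gens.get j).g.1 ∨ (cc.gens.get i).g.2.1 ≠ (cc.gens.get j).g.2.1 ∨
        (cc.gens.get i).g.2.2 ≠ (cc.gens.get j).g.2.2 := by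
      by_contra hcon
      simp only [ne_eq, not_or, not_not] at hcon
      exact hgne (Prod.ext hcon.1 (Prod.ext hcon.2.1 hcon.2.2))
    exact lin_ne hirr hα h3 hne3 hij
  -- the support of F′(θ)
  have hu : IsUnit (lin hα cc.u.1 cc.u.2.1 cc.u.2.2) := isUnit_lin_of_coords hα cc.u cc.uinv huinv
  have hder' := deriv_eq_of_coords hα cc.t cc.u (cc.gens.map fun d => (d.g, d.e)) hder
  have hD : ∀ q : 𝓞 K, Prime q →
      q ∣ 3 * (lin hα cc.t.1 cc.t.2.1 cc.t.2.2) ^ 2 + 2 * (cc.A : 𝓞 K) * (lin hα cc.t.1 cc.t.2.1 cc.t.2.2) + (cc.B : 𝓞 K) →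
      ∃ j, Associated q (G j) := by
    intro q hq hdvd
    have hdvd' : q ∣ lin hα cc.u.1 cc.u.2.1 cc.u.2.2 *
        ((cc.gens.map fun d => (d.g, d.e)).map fun ge => (lin hα ge.1.1 ge.1.2.1 ge.1.2.2) ^ ge.2).prod := by
      have e : (3 : 𝓞 K) * (lin hα cc.t.1 cc.t.2.1 cc.t.2.2) ^ 2 + 2 * ((cc.A : ℤ) : 𝓞 K) * (lin hα cc.t.1 cc.t.2.1 cc.t.2.2) +
          ((cc.B : ℤ) : 𝓞 K) = _ := hder'
      rw [← e]
      simpa using hdvd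
    rcases hq.dvd_or_dvd hdvd' with h1 | h1
    · exact absurd (isUnit_of_dvd_unit h1 hu) hq.not_unit
    rw [List.map_map] at h1
    obtain ⟨x, hx, hqx⟩ := (Prime.dvd_prod_iff hq).mp h1
    rw [List.mem_map] at hx
    obtain ⟨d, hd, rfl⟩ := hx
    obtain ⟨j, hj⟩ := List.mem_iff_get.mp hd
    refine ⟨j, ?_⟩
    have hqd : q ∣ lin hα d.g.1 d.g.2.1 d.g.2.2 := hq.dvd_of_dvd_pow hqx
    have hGj : G j = lin hα d.g.1 d.g.2.1 d.g.2.2 := by simp only [hG, hj]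
    rw [hGj]
    exact hq.associated_of_dvd (hj ▸ hGp j) hqd
  -- admissibility
  have hq := cofactor_pos_of_disc_neg (rho_theta_root ρ haev) hdisc
  have hQpos : ∀ q ∈ cc.Q, 0 < q := fun q hq' => hQ q hq'
  have hadm : ∀ x y : ℚ, y ^ 2 = x ^ 3 + cc.A * x ^ 2 + cc.B * x + cc.C →
      ∀ (T : Finset (Fin m)) (U : Finset (Fin s)),
        IsSquare ((algebraMap ℚ K x - algebraMap (𝓞 K) K (lin hα cc.t.1 cc.t.2.1 cc.t.2.2)) *
          (∏ i ∈ T, algebraMap (𝓞 K) K (Wu i)) * ∏ j ∈ U, algebraMap (𝓞 K) K (G j)) →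
        cc.adm a b c ucoords Nu su T U = true := by
    intro x y hxy T U hsq
    have hstd := admStd_sound hirrF' haev h3 ρ hq
      (w := fun i => algebraMap (𝓞 K) K (Wu i)) (g := fun j => algebraMap (𝓞 K) K (G j))
      (fun i => (RingOfIntegers.coe_ne_zero_iff).mpr (Units.ne_zero _))
      (fun j => (RingOfIntegers.coe_ne_zero_iff).mpr (hGp j).ne_zero)
      (Nu := Nu) (fun i => hNu i)
      (Ng := fun j => (cc.gens.get j).n) (fun j => GenData.norm_of_check hirr hα h3 (hGchk j))
      (su := su) hsu
      (sg := fun j => (cc.gens.get j).sg) (fun j => GenData.sign_iff_of_check hα ρ h0 hlo hhi (hGchk j))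
      x y hxy T U hsq
    have hstdQ := admStdQ_of_admStd (Q := cc.Q) hQpos hstd
    exact admKills_sound hirr hα h3 cc.t.1 (fun i => ((Wu i : (𝓞 K)ˣ) : 𝓞 K)) G hWu (fun j => rfl) hkill
      hstdQ x hsq
  -- the count
  exact mordellWeilRank_le_of_coverSet_lt (A := cc.A) (B := cc.B) (C := cc.C)
    (⟨0, cc.A, 0, cc.B, cc.C⟩ : WeierstrassCurve ℚ) rfl rfl rfl rfl rfl hirrF' haev h3 hGi
    (fun j => (hGp j).ne_zero) hD hW
    (adm := cc.adm a b c ucoords Nu su) (admKills_empty (admStdQ_empty cc.Q hQpos _ _ _ _)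
      (List.all_eq_true.mpr hTU)) hadm hcount

/-- **`rank E(ℚ) = r` from an `r`-checked row and the tree's lower bound `r ≤ rank`** (the shape of every sharded
per-curve declaration: `rank_eq_of_checkLe r <field data…> ⟨row⟩ (by decide +kernel) (by norm_num …) <lower bound>`, e.g. for
`r = 3` the tree certificate `Rank3KernelCerts<k>.C<label>.three_le_rank`). [cite: CremonaAlgorithms1997, §3.6] -/
theorem rank_eq_of_checkLe (r : ℕ) [IsPrincipalIdealRing (𝓞 K)]
    (hirr : Irreducible (MonicCubic.polyQ a b c)) (hα : aeval α (MonicCubic.poly a b c) = 0)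
    (h3 : finrank ℚ K = 3) {m : ℕ} (Wu : Fin m → (𝓞 K)ˣ)
    (hW : ∀ u : (𝓞 K)ˣ, ∃ T : Finset (Fin m), IsSquare (u * ∏ i ∈ T, Wu i))
    (ucoords : Fin m → ℤ × ℤ × ℤ)
    (hWu : ∀ i, ((Wu i : (𝓞 K)ˣ) : 𝓞 K) = lin hα (ucoords i).1 (ucoords i).2.1 (ucoords i).2.2)
    {Nu : Fin m → ℤ} (hNu : ∀ i, Algebra.norm ℚ (((Wu i : (𝓞 K)ˣ) : 𝓞 K) : K) = Nu i)
    (ρ : K →+* ℝ) {lo hi : ℚ} (h0 : 0 ≤ lo) (hlo : ((lo : ℚ) : ℝ) < ρ α) (hhi : ρ α < ((hi : ℚ) : ℝ))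
    {su : Fin m → Bool} (hsu : ∀ i, (su i = true ↔ ρ (((Wu i : (𝓞 K)ˣ) : 𝓞 K) : K) < 0))
    (cc : CurveCert m) (hc : cc.checkLe r a b c lo hi ucoords Nu su = true)
    (hprimes : (cc.gens.map GenData.p).Forall Nat.Prime)
    (hlow : r ≤ (((⟨0, cc.A, 0, cc.B, cc.C⟩ : WeierstrassCurve ℤ)).map (Int.castRingHom ℚ)).mordellWeilRank) :
    (((⟨0, cc.A, 0, cc.B, cc.C⟩ : WeierstrassCurve ℤ)).map (Int.castRingHom ℚ)).mordellWeilRank = r := by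
  have hE : ((⟨0, cc.A, 0, cc.B, cc.C⟩ : WeierstrassCurve ℤ)).map (Int.castRingHom ℚ) =
      (⟨0, cc.A, 0, cc.B, cc.C⟩ : WeierstrassCurve ℚ) := by
    ext <;> simp [WeierstrassCurve.map]
  refine le_antisymm ?_ hlow
  rw [hE]
  exact rank_le_of_checkLe r hirr hα h3 Wu hW ucoords hWu hNu ρ h0 hlo hhi hsu cc hc hprimes

/-- **`rank E(ℚ) = r` for the ORIGINAL model** `(a₁, a₂, a₃, a₄, a₆)` when the row certifies its completed-square
model `(0, a₁² + 4a₂, 0, 8(a₁a₃ + 2a₄), 16(a₃² + 4a₆))` (`x = x′/4`, `y = y′/8 − (a₁x + a₃)/2`; the rank is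
invariant, `mordellWeilRank_variableChange`). [cite: CremonaAlgorithms1997, §3.6] -/
theorem rank_eq_of_checkLe_complSq (r : ℕ) [IsPrincipalIdealRing (𝓞 K)]
    (hirr : Irreducible (MonicCubic.polyQ a b c)) (hα : aeval α (MonicCubic.poly a b c) = 0)
    (h3 : finrank ℚ K = 3) {m : ℕ} (Wu : Fin m → (𝓞 K)ˣ)
    (hW : ∀ u : (𝓞 K)ˣ, ∃ T : Finset (Fin m), IsSquare (u * ∏ i ∈ T, Wu i))
    (ucoords : Fin m → ℤ × ℤ × ℤ)
    (hWu : ∀ i, ((Wu i : (𝓞 K)ˣ) : 𝓞 K) = lin hα (ucoords i).1 (ucoords i).2.1 (ucoords i).2.2)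
    {Nu : Fin m → ℤ} (hNu : ∀ i, Algebra.norm ℚ (((Wu i : (𝓞 K)ˣ) : 𝓞 K) : K) = Nu i)
    (ρ : K →+* ℝ) {lo hi : ℚ} (h0 : 0 ≤ lo) (hlo : ((lo : ℚ) : ℝ) < ρ α) (hhi : ρ α < ((hi : ℚ) : ℝ))
    {su : Fin m → Bool} (hsu : ∀ i, (su i = true ↔ ρ (((Wu i : (𝓞 K)ˣ) : 𝓞 K) : K) < 0))
    (cc : CurveCert m) (hc : cc.checkLe r a b c lo hi ucoords Nu su = true)
    (hprimes : (cc.gens.map GenData.p).Forall Nat.Prime) (a₁ a₂ a₃ a₄ a₆ : ℤ)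
    (hABC : cc.A = a₁ ^ 2 + 4 * a₂ ∧ cc.B = 8 * (a₁ * a₃ + 2 * a₄) ∧ cc.C = 16 * (a₃ ^ 2 + 4 * a₆))
    (hlow : r ≤ (((⟨a₁, a₂, a₃, a₄, a₆⟩ : WeierstrassCurve ℤ)).map (Int.castRingHom ℚ)).mordellWeilRank) :
    (((⟨a₁, a₂, a₃, a₄, a₆⟩ : WeierstrassCurve ℤ)).map (Int.castRingHom ℚ)).mordellWeilRank = r := by
  obtain ⟨hA, hB, hC⟩ := hABC
  have hE : ((⟨0, cc.A, 0, cc.B, cc.C⟩ : WeierstrassCurve ℤ)).map (Int.castRingHom ℚ) =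
      (⟨0, cc.A, 0, cc.B, cc.C⟩ : WeierstrassCurve ℚ) := by
    ext <;> simp [WeierstrassCurve.map]
  have hV : ((⟨0, cc.A, 0, cc.B, cc.C⟩ : WeierstrassCurve ℤ)).map (Int.castRingHom ℚ) =
      (⟨Units.mk0 (1 / 2 : ℚ) (by norm_num), 0, -(a₁ : ℚ) / 2, -(a₃ : ℚ) / 2⟩ :
        WeierstrassCurve.VariableChange ℚ) •
        (((⟨a₁, a₂, a₃, a₄, a₆⟩ : WeierstrassCurve ℤ)).map (Int.castRingHom ℚ)) := by
    ext <;> simp only [WeierstrassCurve.map_a₁, WeierstrassCurve.map_a₂, WeierstrassCurve.map_a₃,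
      WeierstrassCurve.map_a₄, WeierstrassCurve.map_a₆, WeierstrassCurve.variableChange_a₁,
      WeierstrassCurve.variableChange_a₂, WeierstrassCurve.variableChange_a₃,
      WeierstrassCurve.variableChange_a₄, WeierstrassCurve.variableChange_a₆, Units.val_inv_eq_inv_val,
      Units.val_mk0, hA, hB, hC, eq_intCast, Int.cast_zero] <;> push_cast <;> ring
  have hr : (((⟨0, cc.A, 0, cc.B, cc.C⟩ : WeierstrassCurve ℤ)).map (Int.castRingHom ℚ)).mordellWeilRank =
      (((⟨a₁, a₂, a₃, a₄, a₆⟩ : WeierstrassCurve ℤ)).map (Int.castRingHom ℚ)).mordellWeilRank := by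
    rw [hV]; exact WeierstrassCurve.mordellWeilRank_variableChange_holds _ _
  rw [← hr] at hlow ⊢
  refine le_antisymm ?_ hlow
  rw [hE]
  exact rank_le_of_checkLe r hirr hα h3 Wu hW ucoords hWu hNu ρ h0 hlo hhi hsu cc hc hprimes

end assembly

/-! ## Kernel sanity checks on census data -/

/-- The landed `10120g1` row (field `−23`; the `check` example of `Rank2Observatory2DescRowCert`) passes the
`2`-checker. [cite: CremonaAlgorithms1997, §3.5 (label `10120g1`)] -/
example : CurveCert.checkLe 2 0 (-1) (-1) (331 / 250) (53 / 40) ![((-1 : ℤ), 0, 0), (1, 0, -1)] ![-1, -1] ![true, true]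
    (⟨0, -2743, 56767, 2, (12, -31, -18), (0, -1, -1), (1, -1, 0),
      [⟨(-1, 1, -2), -25, 5, 2, 1, true⟩, ⟨(5, 4, -3), 121, 11, 2, 2, false⟩, ⟨(1, 3, -1), 23, 23, 1, 3, false⟩],
      [4], [⟨[1], [0], 2, 2⟩]⟩ : CurveCert 2) = true := by
  decide +kernel

/-- The KILL-R3 row of the rank-3 curve `248124a1 = [0, −1, 0, −442, 4321]` over the field `−31`
(`α³ + α − 1 = 0`, units `(−1, 1 + α²)` of norms `(−1, 1)`, signs `(−, +)`, `341/500 < ρ(α) < 683/1000`;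
v1.x file `Rank2Observatory248124a1TwoDescRankThree`): `16` admissible classes, the class of `1 + α²`
killed modulo `2²`, `15 < 2⁴` — the `3`-checker accepts it … [cite: CremonaAlgorithms1997, §3.5 (label `248124a1`)] -/
example : CurveCert.checkLe 3 0 1 (-1) (341 / 500) (683 / 1000) ![((-1 : ℤ), 0, 0), (1, 0, 1)] ![-1, 1] ![true, false]
    (⟨-1, -442, 4321, 2, (-9, -13, -14), (2, 1, 1), (1, -1, 0),
      [⟨(-2, 1, -1), -9, 3, 2, 1, true⟩, ⟨(6, 4, -1), 529, 23, 2, 1, false⟩, ⟨(-1, -9, -3), -841, 29, 2, 1, true⟩,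
        ⟨(1, 3, 1), 31, 31, 1, 1, false⟩],
      [4], [⟨[1], [], 2, 1⟩]⟩ : CurveCert 2) = true := by
  decide +kernel

/-- … and the `2`-checker rejects it (`15` surviving classes is not `< 2³`): the rank bound certified by this
row is `3`, not `2`. [cite: CremonaAlgorithms1997, §3.5 (label `248124a1`)] -/
example : CurveCert.checkLe 2 0 1 (-1) (341 / 500) (683 / 1000) ![((-1 : ℤ), 0, 0), (1, 0, 1)] ![-1, 1] ![true, false]
    (⟨-1, -442, 4321, 2, (-9, -13, -14), (2, 1, 1), (1, -1, 0),
      [⟨(-2, 1, -1), -9, 3, 2, 1, true⟩, ⟨(6, 4, -1), 529, 23, 2, 1, false⟩, ⟨(-1, -9, -3), -841, 29, 2, 1, true⟩,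
        ⟨(1, 3, 1), 31, 31, 1, 1, false⟩],
      [4], [⟨[1], [], 2, 1⟩]⟩ : CurveCert 2) = false := by
  decide +kernel

end Summit.BirchSwinnertonDyer.BirchSwinnertonDyer.Rank2Observatory.TwoDescCubic
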